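import Summits.BirchSwinnertonDyer.BirchSwinnertonDyer.Theorems.ShaPrimaryTransferFiniteShaComponentTransferSelmerCubicQ2Row
import Summits.BirchSwinnertonDyer.BirchSwinnertonDyer.Theorems.ShaPrimaryTransferFiniteShaComponentTransferSelmerCubicQ2KRow
import HarnessLib

/-!
# BirchSwinnertonDyer — SEL2CUBIC doors for the TWO-AUXILIARY-PRIME census rows: the `K`-free row shapes
# (`rank_eq_two_of_certs₂`, `rank_eq_two_of_certs_complSq₂`, `rank_eq_of_certsK₂`, `rank_eq_of_certsK₂_complSq`) and the row kit

HONEST FRAMING: route `ShaPrimaryTransfer`, seat `bsd-line-spt-p1` (g31), `--supports` item T =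
`FiniteShaComponentTransfer` (stmt-22356), UNCHANGED (conjecture-grade at corank ≥ 2). BSD in rank ≥ 2 is NOT
proved by any of this. THEOREMS ONLY.

The doors `sha_door_of_check_cl₂` (`…SelmerCubicQ2Row`) and `sha_door_of_checkK₂` (`…SelmerCubicQ2KRow`) over the
abstract cubic field `CubicField a b c`, in the exact argument shapes of the census rows over two-auxiliary-prime field
records (`Rank2ObservatoryTwoDescClQ2Rows*`: 91 rank-2 rows `rank_eq_two_of_certs₂` / `…_complSq₂`;
`Rank2ObservatoryTwoDescClQ2K{,R3}Rows*`: 589 rows `rank_eq_of_certsK₂` / `…_complSq`, 572 of them RANK-3 rows with an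
EMPTY kill list), so that each becomes an unconditional `t₂(E) = 0 ∧ Ш(E/ℚ)[2^∞] = 0 ∧ rank E(ℚ) = r` theorem by swapping
the theorem name (g30 recipe, HOME `SEL2CUBIC-g30-data/README.md` §2):

* `sha_door_of_certs₂`, `shaCorank_two_eq_zero_of_certs_complSq₂` (no kill list, `r = 2`);
* `sha_door_of_certsK₂`, `shaCorank_two_eq_zero_of_certsK₂_complSq` (kill list, kills in RESIDUE form);
* the row kit `killResidueQ2_nil` / `killResidueQ2_cons` / `killResidueQ2_cons_z` replacing `killValidQ2_nil` /
  `killValidQ2_cons` / `killValidQ2_cons_z` (a residue certificate `killResidue_of_<shape> … (by decide +kernel)` in place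
  of `killValidAt_of_<shape>`; the VALIDITY-only certificates `qkCert_sound` / `conicCert_sound` of 17 rows have no
  residue form here and those rows are not covered).
Transport along the models: `…SelmerCubicDoorTransport`. [cite: Cassels1991LecturesEllipticCurves, §15]
[cite: SilvermanAEC2009, Thm. X.4.2, Rem. X.4.1] [cite: CremonaAlgorithms1997, §3.6]
-/

-- single-conjunct summit: `Summit.BirchSwinnertonDyer.BirchSwinnertonDyer.…` repeats the name by design
set_option linter.dupNamespace false

noncomputable section

open scoped Classical

open Literature.NumberTheory.NumberFields Literature.NumberTheory.EllipticCurves WeierstrassCurve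

namespace Summit.BirchSwinnertonDyer.BirchSwinnertonDyer.Theorems.ShaPrimaryTransferSelmerCubicCover

open Summit.BirchSwinnertonDyer.BirchSwinnertonDyer.Rank2Observatory
open Summit.BirchSwinnertonDyer.BirchSwinnertonDyer.Rank2Observatory.TwoDescCubic
open Summit.BirchSwinnertonDyer.BirchSwinnertonDyer.Rank2Observatory.TwoDescCl
open Summit.BirchSwinnertonDyer.BirchSwinnertonDyer.Rank2Observatory.TwoDescKill

/-! ## Rows without a kill list (`check₂`, rank `2`) -/

section Q2

/-- **`K`-free door shape** (model `(0, A, 0, B, C)` read over `ℚ` from `ℤ`), in the exact shape of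
`rank_eq_two_of_certs₂`: `sha_door_of_certs₂ <field> ⟨curve⟩ (by decide +kernel) (by norm_num …) (by decide +kernel)
<lower bound>`. [cite: Cassels1991LecturesEllipticCurves, §15] [cite: CremonaAlgorithms1997, §3.6] -/
theorem sha_door_of_certs₂ (fc : ClFieldCertQ2) (cc : ClCurveCertQ2) (hF : fc.check = true)
    (hpr : fc.primeList.Forall Nat.Prime) (hc : check₂ fc cc = true)
    (hlow : 2 ≤ (((⟨0, cc.A, 0, cc.B, cc.C⟩ : WeierstrassCurve ℤ)).map (Int.castRingHom ℚ)).mordellWeilRank) :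
    (((⟨0, cc.A, 0, cc.B, cc.C⟩ : WeierstrassCurve ℤ)).map (Int.castRingHom ℚ)).shaCorank 2 = 0 ∧
      AddCommGroup.primaryComponent (((⟨0, cc.A, 0, cc.B, cc.C⟩ : WeierstrassCurve ℤ)).map (Int.castRingHom ℚ)).sha 2 = ⊥ ∧
        (((⟨0, cc.A, 0, cc.B, cc.C⟩ : WeierstrassCurve ℤ)).map (Int.castRingHom ℚ)).mordellWeilRank = 2 := by
  haveI : Fact (Irreducible (MonicCubic.polyQ fc.a fc.b fc.c)) := ⟨fc.irreducible_of_check hF⟩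
  exact sha_door_map_of_door (fun h => sha_door_of_check_cl₂ (K := CubicField fc.a fc.b fc.c) fc
      (CubicField.aeval_root fc.a fc.b fc.c) (CubicField.finrank_eq fc.a fc.b fc.c) hF hpr cc hc h) hlow

/-- `Δ ≠ 0` is the first clause of `check₂`. [folklore] -/
theorem deltaShort_ne_of_check₂ {fc : ClFieldCertQ2} {cc : ClCurveCertQ2} (hc : check₂ fc cc = true) :
    deltaShort cc.A cc.B cc.C ≠ 0 := by
  simp only [check₂, Bool.and_eq_true, decide_eq_true_eq] at hc
  exact hc.1.1.1.1.1.1.1.1.1.1.1.1.1.1.1.1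

/-- **`t₂(E) = 0 ∧ rank E(ℚ) = 2` for the ORIGINAL model** `(a₁, a₂, a₃, a₄, a₆)` when the records certify its
completed-square model, in the shape of `rank_eq_two_of_certs_complSq₂`. [cite: CremonaAlgorithms1997, §3.6]
[cite: SilvermanAEC2009, III.3.1(b), Thm. X.4.2] -/
theorem shaCorank_two_eq_zero_of_certs_complSq₂ (fc : ClFieldCertQ2) (cc : ClCurveCertQ2) (hF : fc.check = true)
    (hpr : fc.primeList.Forall Nat.Prime) (hc : check₂ fc cc = true) (a₁ a₂ a₃ a₄ a₆ : ℤ)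
    (hABC : cc.A = a₁ ^ 2 + 4 * a₂ ∧ cc.B = 8 * (a₁ * a₃ + 2 * a₄) ∧ cc.C = 16 * (a₃ ^ 2 + 4 * a₆))
    (hlow : 2 ≤ (((⟨a₁, a₂, a₃, a₄, a₆⟩ : WeierstrassCurve ℤ)).map (Int.castRingHom ℚ)).mordellWeilRank) :
    (((⟨a₁, a₂, a₃, a₄, a₆⟩ : WeierstrassCurve ℤ)).map (Int.castRingHom ℚ)).shaCorank 2 = 0 ∧
      (((⟨a₁, a₂, a₃, a₄, a₆⟩ : WeierstrassCurve ℤ)).map (Int.castRingHom ℚ)).mordellWeilRank = 2 := by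
  haveI : Fact (Irreducible (MonicCubic.polyQ fc.a fc.b fc.c)) := ⟨fc.irreducible_of_check hF⟩
  exact shaCorank_two_transport_complSq a₁ a₂ a₃ a₄ a₆ hABC (deltaShort_ne_of_check₂ hc)
    (fun h => sha_door_of_check_cl₂ (K := CubicField fc.a fc.b fc.c) fc
      (CubicField.aeval_root fc.a fc.b fc.c) (CubicField.finrank_eq fc.a fc.b fc.c) hF hpr cc hc h) hlow

end Q2

/-! ## Rows with a kill list (`checkK₂ r`, kills in residue form) -/

section Q2K

variable {fc : ClFieldCertQ2} {cc : ClCurveCertQ2}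

/-- The kill hypothesis of the empty kill list (572 rank-3 rows). [folklore] -/
theorem killResidueQ2_nil :
    ∀ k ∈ ([] : List ClKill), k.p.Prime ∧ ∃ N : ℕ, ∀ v : ℤ × ℤ × ℤ × ℤ,
      ¬ ((k.p : ℤ) ∣ v.1 ∧ (k.p : ℤ) ∣ v.2.1 ∧ (k.p : ℤ) ∣ v.2.2.1 ∧ (k.p : ℤ) ∣ v.2.2.2) →
      (k.p : ℤ) ^ N ∣ (killQ fc.a fc.b fc.c (k.z₂ fc cc) cc.t.2.1 cc.t.2.2 v).1 →
      (k.p : ℤ) ^ N ∣ (killQ fc.a fc.b fc.c (k.z₂ fc cc) cc.t.2.1 cc.t.2.2 v).2 → False := by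
  simp

/-- Prepend one kill: its prime is prime (`by norm_num`) and its class carries a RESIDUE certificate there, by any
residue certificate shape (`killResidue_of_killCheck`, `killResidue_of_sig3Check`, `killResidue_of_sig2xCheck`, …, the
census tree `(by decide +kernel)` unchanged). [folklore] -/
theorem killResidueQ2_cons {k : ClKill} {ks : List ClKill} (hp : k.p.Prime)
    (h₁ : ∃ N : ℕ, ∀ v : ℤ × ℤ × ℤ × ℤ,
      ¬ ((k.p : ℤ) ∣ v.1 ∧ (k.p : ℤ) ∣ v.2.1 ∧ (k.p : ℤ) ∣ v.2.2.1 ∧ (k.p : ℤ) ∣ v.2.2.2) →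
      (k.p : ℤ) ^ N ∣ (killQ fc.a fc.b fc.c (k.z₂ fc cc) cc.t.2.1 cc.t.2.2 v).1 →
      (k.p : ℤ) ^ N ∣ (killQ fc.a fc.b fc.c (k.z₂ fc cc) cc.t.2.1 cc.t.2.2 v).2 → False)
    (h : ∀ k ∈ ks, k.p.Prime ∧ ∃ N : ℕ, ∀ v : ℤ × ℤ × ℤ × ℤ,
      ¬ ((k.p : ℤ) ∣ v.1 ∧ (k.p : ℤ) ∣ v.2.1 ∧ (k.p : ℤ) ∣ v.2.2.1 ∧ (k.p : ℤ) ∣ v.2.2.2) →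
      (k.p : ℤ) ^ N ∣ (killQ fc.a fc.b fc.c (k.z₂ fc cc) cc.t.2.1 cc.t.2.2 v).1 →
      (k.p : ℤ) ^ N ∣ (killQ fc.a fc.b fc.c (k.z₂ fc cc) cc.t.2.1 cc.t.2.2 v).2 → False) :
    ∀ k' ∈ k :: ks, k'.p.Prime ∧ ∃ N : ℕ, ∀ v : ℤ × ℤ × ℤ × ℤ,
      ¬ ((k'.p : ℤ) ∣ v.1 ∧ (k'.p : ℤ) ∣ v.2.1 ∧ (k'.p : ℤ) ∣ v.2.2.1 ∧ (k'.p : ℤ) ∣ v.2.2.2) →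
      (k'.p : ℤ) ^ N ∣ (killQ fc.a fc.b fc.c (k'.z₂ fc cc) cc.t.2.1 cc.t.2.2 v).1 →
      (k'.p : ℤ) ^ N ∣ (killQ fc.a fc.b fc.c (k'.z₂ fc cc) cc.t.2.1 cc.t.2.2 v).2 → False := by
  intro k' hk'
  rcases List.mem_cons.mp hk' with rfl | hm
  · exact ⟨hp, h₁⟩
  · exact h k' hm

/-- `killResidueQ2_cons` with the class representative supplied as an explicit literal `z` and the identity
`k.z₂ fc cc = z` checked by the kernel (`by decide +kernel` in a row), in the shape of `killValidQ2_cons_z`. [folklore] -/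
theorem killResidueQ2_cons_z {k : ClKill} {ks : List ClKill} (z : ℤ × ℤ × ℤ) (hz : k.z₂ fc cc = z)
    (hp : k.p.Prime)
    (h₁ : ∃ N : ℕ, ∀ v : ℤ × ℤ × ℤ × ℤ,
      ¬ ((k.p : ℤ) ∣ v.1 ∧ (k.p : ℤ) ∣ v.2.1 ∧ (k.p : ℤ) ∣ v.2.2.1 ∧ (k.p : ℤ) ∣ v.2.2.2) →
      (k.p : ℤ) ^ N ∣ (killQ fc.a fc.b fc.c z cc.t.2.1 cc.t.2.2 v).1 →
      (k.p : ℤ) ^ N ∣ (killQ fc.a fc.b fc.c z cc.t.2.1 cc.t.2.2 v).2 → False)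
    (h : ∀ k ∈ ks, k.p.Prime ∧ ∃ N : ℕ, ∀ v : ℤ × ℤ × ℤ × ℤ,
      ¬ ((k.p : ℤ) ∣ v.1 ∧ (k.p : ℤ) ∣ v.2.1 ∧ (k.p : ℤ) ∣ v.2.2.1 ∧ (k.p : ℤ) ∣ v.2.2.2) →
      (k.p : ℤ) ^ N ∣ (killQ fc.a fc.b fc.c (k.z₂ fc cc) cc.t.2.1 cc.t.2.2 v).1 →
      (k.p : ℤ) ^ N ∣ (killQ fc.a fc.b fc.c (k.z₂ fc cc) cc.t.2.1 cc.t.2.2 v).2 → False) :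
    ∀ k' ∈ k :: ks, k'.p.Prime ∧ ∃ N : ℕ, ∀ v : ℤ × ℤ × ℤ × ℤ,
      ¬ ((k'.p : ℤ) ∣ v.1 ∧ (k'.p : ℤ) ∣ v.2.1 ∧ (k'.p : ℤ) ∣ v.2.2.1 ∧ (k'.p : ℤ) ∣ v.2.2.2) →
      (k'.p : ℤ) ^ N ∣ (killQ fc.a fc.b fc.c (k'.z₂ fc cc) cc.t.2.1 cc.t.2.2 v).1 →
      (k'.p : ℤ) ^ N ∣ (killQ fc.a fc.b fc.c (k'.z₂ fc cc) cc.t.2.1 cc.t.2.2 v).2 → False := by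
  subst hz
  exact killResidueQ2_cons hp h₁ h

variable (fc cc)

/-- **`K`-free door shape with a kill list**, in the exact shape of `rank_eq_of_certsK₂` (the kill hypothesis in
residue form): `sha_door_of_certsK₂ r <field> ⟨curve⟩ [kills] <field>.check <field>.primes (by decide +kernel) <hk>
<lower bound>`. [cite: Cassels1991LecturesEllipticCurves, §15] [cite: CremonaAlgorithms1997, §3.6] -/
theorem sha_door_of_certsK₂ (r : ℕ) (fc : ClFieldCertQ2) (cc : ClCurveCertQ2) (ks : List ClKill)
    (hF : fc.check = true) (hpr : fc.primeList.Forall Nat.Prime) (hc : checkK₂ fc cc r ks = true)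
    (hk : ∀ k ∈ ks, k.p.Prime ∧ ∃ N : ℕ, ∀ v : ℤ × ℤ × ℤ × ℤ,
      ¬ ((k.p : ℤ) ∣ v.1 ∧ (k.p : ℤ) ∣ v.2.1 ∧ (k.p : ℤ) ∣ v.2.2.1 ∧ (k.p : ℤ) ∣ v.2.2.2) →
      (k.p : ℤ) ^ N ∣ (killQ fc.a fc.b fc.c (k.z₂ fc cc) cc.t.2.1 cc.t.2.2 v).1 →
      (k.p : ℤ) ^ N ∣ (killQ fc.a fc.b fc.c (k.z₂ fc cc) cc.t.2.1 cc.t.2.2 v).2 → False)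
    (hlow : r ≤ (((⟨0, cc.A, 0, cc.B, cc.C⟩ : WeierstrassCurve ℤ)).map (Int.castRingHom ℚ)).mordellWeilRank) :
    (((⟨0, cc.A, 0, cc.B, cc.C⟩ : WeierstrassCurve ℤ)).map (Int.castRingHom ℚ)).shaCorank 2 = 0 ∧
      AddCommGroup.primaryComponent (((⟨0, cc.A, 0, cc.B, cc.C⟩ : WeierstrassCurve ℤ)).map (Int.castRingHom ℚ)).sha 2 = ⊥ ∧
        (((⟨0, cc.A, 0, cc.B, cc.C⟩ : WeierstrassCurve ℤ)).map (Int.castRingHom ℚ)).mordellWeilRank = r := by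
  haveI : Fact (Irreducible (MonicCubic.polyQ fc.a fc.b fc.c)) := ⟨fc.irreducible_of_check hF⟩
  exact sha_door_map_of_door (fun h => sha_door_of_checkK₂ (K := CubicField fc.a fc.b fc.c) r fc
      (CubicField.aeval_root fc.a fc.b fc.c) (CubicField.finrank_eq fc.a fc.b fc.c) hF hpr cc ks hc hk h) hlow

variable {fc cc}

/-- `Δ ≠ 0` is the first clause of `checkK₂`. [folklore] -/
theorem deltaShort_ne_of_checkK₂ {r : ℕ} {ks : List ClKill} (hc : checkK₂ fc cc r ks = true) :
    deltaShort cc.A cc.B cc.C ≠ 0 := by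
  simp only [checkK₂, Bool.and_eq_true, decide_eq_true_eq] at hc
  exact hc.1.1.1.1.1.1.1.1.1.1.1.1.1.1.1.1.1

/-- **`t₂(E) = 0 ∧ rank E(ℚ) = r` for the ORIGINAL model** `(a₁, a₂, a₃, a₄, a₆)` when the records (with a kill list)
certify its completed-square model, in the shape of `rank_eq_of_certsK₂_complSq`. [cite: CremonaAlgorithms1997, §3.6]
[cite: SilvermanAEC2009, III.3.1(b), Thm. X.4.2] -/
theorem shaCorank_two_eq_zero_of_certsK₂_complSq (r : ℕ) (fc : ClFieldCertQ2) (cc : ClCurveCertQ2) (ks : List ClKill)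
    (hF : fc.check = true) (hpr : fc.primeList.Forall Nat.Prime) (hc : checkK₂ fc cc r ks = true)
    (hk : ∀ k ∈ ks, k.p.Prime ∧ ∃ N : ℕ, ∀ v : ℤ × ℤ × ℤ × ℤ,
      ¬ ((k.p : ℤ) ∣ v.1 ∧ (k.p : ℤ) ∣ v.2.1 ∧ (k.p : ℤ) ∣ v.2.2.1 ∧ (k.p : ℤ) ∣ v.2.2.2) →
      (k.p : ℤ) ^ N ∣ (killQ fc.a fc.b fc.c (k.z₂ fc cc) cc.t.2.1 cc.t.2.2 v).1 →
      (k.p : ℤ) ^ N ∣ (killQ fc.a fc.b fc.c (k.z₂ fc cc) cc.t.2.1 cc.t.2.2 v).2 → False)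
    (a₁ a₂ a₃ a₄ a₆ : ℤ)
    (hABC : cc.A = a₁ ^ 2 + 4 * a₂ ∧ cc.B = 8 * (a₁ * a₃ + 2 * a₄) ∧ cc.C = 16 * (a₃ ^ 2 + 4 * a₆))
    (hlow : r ≤ (((⟨a₁, a₂, a₃, a₄, a₆⟩ : WeierstrassCurve ℤ)).map (Int.castRingHom ℚ)).mordellWeilRank) :
    (((⟨a₁, a₂, a₃, a₄, a₆⟩ : WeierstrassCurve ℤ)).map (Int.castRingHom ℚ)).shaCorank 2 = 0 ∧
      (((⟨a₁, a₂, a₃, a₄, a₆⟩ : WeierstrassCurve ℤ)).map (Int.castRingHom ℚ)).mordellWeilRank = r := by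
  haveI : Fact (Irreducible (MonicCubic.polyQ fc.a fc.b fc.c)) := ⟨fc.irreducible_of_check hF⟩
  exact shaCorank_two_transport_complSq a₁ a₂ a₃ a₄ a₆ hABC (deltaShort_ne_of_checkK₂ hc)
    (fun h => sha_door_of_checkK₂ (K := CubicField fc.a fc.b fc.c) r fc
      (CubicField.aeval_root fc.a fc.b fc.c) (CubicField.finrank_eq fc.a fc.b fc.c) hF hpr cc ks hc hk h) hlow

end Q2K

end Summit.BirchSwinnertonDyer.BirchSwinnertonDyer.Theorems.ShaPrimaryTransferSelmerCubicCover

end
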